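import Mathlib
import HarnessLib
/-!
# The drain closure of the ℓ-reduced class-E profile equation and its constant `C₀ = 2/3`

HONEST FRAMING (cell ns-blowup GROUP B «PROFILE SEARCH», zone Z6 «Elgindi-type C^{1,α} no-swirl self-similar blow-up»; human
rulings D-0035/D-0074/D-0081): elementary calculus and real algebra about a TWO-ODE CLOSURE (eng-10 g5, HOME/profile/z6twin/asym/
LIMIT-ANALYSIS.md §4) of the ℓ-REDUCED ν = 0 axisymmetric NO-SWIRL **EULER** class-E profile equation (strain-mode truncation of the
Biot–Savart law, `ElgindiStrainModeCoefficients`) in the limit `ε = 1/(1+δ) → 0`, `α_E = 1/2 − Cε`. A MODEL of a MODEL of a MODEL;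
«violates: none — MODEL (Euler)»; nothing about Navier–Stokes and nothing about existence of profiles.

THE CLOSURE. On the draining plateau (regime III of LIMIT-ANALYSIS §2) write `S = εs′` (slow variable), `Λ(S)` = drained `L₁₂` mass
(`0 → 1/2`), `γ(S) = g/ε` = scaled flux, `μ = m̃/ε → 2C − 1` (normalised axis corner speed). The axis transport law of the reduced
equation (`ElgindiStrainMode.axisSlope_eq` plus the local flux term) and the flux law `dΛ/dS = γ/2` give, under the quasi-steady
angular closure (checked numerically to 1 % on the reduced solutions), `dγ/dS = γ(μ − 4CΛ − γ/3)/(2Λ)` at leading order, hence the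
orbit equation `Λ dγ/dΛ + γ/3 = μ − 4CΛ`. KERNEL-CHECKED HERE:
* `drainOrbit_linear`: the regular orbit is LINEAR, `γ(Λ) = 3μ − 3CΛ` solves `Λγ′ + γ/3 = μ − 4CΛ` (and `drainOrbit_general`:
  every `3μ − 3CΛ + KΛ^{−1/3}` does on `Λ > 0` — the `K ≠ 0` branches are the singular ones);
* `drainOrbit_entry` / `drainOrbit_end`: `γ(0) = 3μ` (the regime-II matching value `g/m̃ → 3`) and `γ = 0` exactly at `Λ = μ/C`;
* `drainConstant_eq_two_thirds`: draining the whole mass, `μ/C = 1/2`, with `μ = 2C − 1` forces **`C = 2/3`**, hence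
  `m_char = 2C − 1 → 1/3` (`drainCornerSpeed_limit`) — the leading-order value of `C₀ = lim (1+δ)(1/2 − α_E)` in the reduced model
  (reduced numerics: 0.6730 / 0.6703 / 0.6695 at δ = 1e4 / 5e4 / 1e5, decreasing toward it);
* `drainTailRate`: at `Λ = 1/2`, `γ = 0` the closure's decay rate `μ − 2C` equals `−1` for every `C` (the far-field law `F ∝ z^{−ε}`),
  so the mass condition is the ONLY constraint fixing `C`.
WHAT IS NOT PROVED: the closure itself (a modelling step resting on the reduced equation and a numerically checked quasi-steady
assumption), the matching value `3μ`, anything about the full class-E system. PLACEMENT: cell-own MODEL lemma next to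
`ElgindiStrainModeCoefficients` / `ElgindiGaugeCornerSpeed` (profile-eng-10); bears on LADDER-NS N5 / zone Z6 case Z6-1 (c)
«death mechanism» (registered pre-statement P-Z6-11) → N1 linear core.
-/

open Real

namespace Summit.NavierStokesRegularity.OSWSelfSimilar
namespace ElgindiDrainClosure

/-- **The regular drain orbit is linear**: `γ(Λ) = 3μ − 3CΛ` satisfies the orbit equation `Λγ′(Λ) + γ(Λ)/3 = μ − 4CΛ`
(`γ′ = −3C`). [new here — MODEL closure algebra; asym/LIMIT-ANALYSIS §4] -/
theorem drainOrbit_linear (μ C Λ : ℝ) :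
    HasDerivAt (fun L : ℝ => 3 * μ - 3 * C * L) (-(3 * C)) Λ
      ∧ Λ * (-(3 * C)) + (3 * μ - 3 * C * Λ) / 3 = μ - 4 * C * Λ := by
  refine ⟨?_, by ring⟩
  have h := ((hasDerivAt_id' Λ).const_mul (3 * C)).const_sub (3 * μ)
  exact h.congr_deriv (by ring)

/-- **General solution on `Λ > 0`**: `γ(Λ) = 3μ − 3CΛ + KΛ^{−1/3}` also satisfies `Λγ′ + γ/3 = μ − 4CΛ`; the branches `K ≠ 0`
blow up at `Λ → 0⁺` and are excluded by matching to the trench regime (`γ → 3μ`). [new here — MODEL closure calculus; asym/LIMIT-ANALYSIS §4] -/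
theorem drainOrbit_general (μ C K : ℝ) {Λ : ℝ} (hΛ : 0 < Λ) :
    HasDerivAt (fun L : ℝ => 3 * μ - 3 * C * L + K * L ^ (-(1 / 3 : ℝ)))
        (-(3 * C) + K * (-(1 / 3 : ℝ) * Λ ^ (-(1 / 3 : ℝ) - 1))) Λ
      ∧ Λ * (-(3 * C) + K * (-(1 / 3 : ℝ) * Λ ^ (-(1 / 3 : ℝ) - 1)))
          + (3 * μ - 3 * C * Λ + K * Λ ^ (-(1 / 3 : ℝ))) / 3 = μ - 4 * C * Λ := by
  constructor
  · have h1 := ((hasDerivAt_id' Λ).const_mul (3 * C)).const_sub (3 * μ)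
    have h2 := (Real.hasDerivAt_rpow_const (p := -(1 / 3 : ℝ)) (Or.inl hΛ.ne')).const_mul K
    exact (h1.add h2).congr_deriv (by simp)
  · have hsplit : Λ ^ (-(1 / 3 : ℝ) - 1) = Λ ^ (-(1 / 3 : ℝ)) * Λ ^ (-(1 : ℝ)) := by
      rw [← Real.rpow_add hΛ]; norm_num
    rw [hsplit, Real.rpow_neg_one]
    field_simp
    ring

/-- **Entry and end of the drain**: `γ(0) = 3μ` (plateau-entry flux `g/m̃ → 3`) and `γ(Λ) = 0 ↔ Λ = μ/C` (`C ≠ 0`).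
[new here — MODEL closure algebra; asym/LIMIT-ANALYSIS §4] -/
theorem drainOrbit_entry_end (μ C : ℝ) (hC : C ≠ 0) :
    (3 * μ - 3 * C * 0 = 3 * μ) ∧ ∀ Λ : ℝ, 3 * μ - 3 * C * Λ = 0 ↔ Λ = μ / C := by
  refine ⟨by ring, fun Λ => ?_⟩
  rw [eq_div_iff hC]
  constructor <;> intro h <;> linarith

/-- **`C₀ = 2/3`**: if the whole `L₁₂` mass `λ₀ → 1/2` drains on the linear orbit (`μ/C = 1/2`) and `μ = 2C − 1` (normalised corner
speed `m̃/ε = 2(C − α) → 2C − 1` at `α → 1/2`), then `C = 2/3` and `μ = 1/3`. [new here — MODEL closure algebra; asym/LIMIT-ANALYSIS §4] -/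
theorem drainConstant_eq_two_thirds {μ C : ℝ} (hC : C ≠ 0) (hmass : μ / C = 1 / 2) (hμ : μ = 2 * C - 1) :
    C = 2 / 3 ∧ μ = 1 / 3 := by
  rw [div_eq_iff hC] at hmass
  constructor <;> linarith

/-- **Converse / consistency**: with `C = 2/3`, `μ = 2C − 1 = 1/3` the orbit `γ = 3μ − 3CΛ = 1 − 2Λ` vanishes exactly at
`Λ = 1/2`. [new here — MODEL closure algebra] -/
theorem drainOrbit_two_thirds (Λ : ℝ) :
    3 * (2 * (2 / 3 : ℝ) - 1) - 3 * (2 / 3 : ℝ) * Λ = 1 - 2 * Λ ∧ (1 - 2 * Λ = 0 ↔ Λ = 1 / 2) := by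
  refine ⟨by ring, ?_⟩
  constructor <;> intro h <;> linarith

/-- **Corner speed in the limit**: `m_char = (1+δ)m̃ → 2C₀ − 1 = 1/3` for `C₀ = 2/3` — positive, so in the closure the branch
never meets the characteristic-reversal line (`ElgindiGaugeCornerSpeed.cornerSpeed_E_pos_iff`). [new here — MODEL closure algebra] -/
theorem drainCornerSpeed_limit : 2 * (2 / 3 : ℝ) - 1 = 1 / 3 ∧ (0 : ℝ) < 1 / 3 := by
  constructor <;> norm_num

/-- **Tail rate is automatic**: at `Λ = 1/2`, `γ = 0` the closure's logarithmic decay rate `(μ − 4CΛ − γ/3)/(2Λ)` equals `μ − 2C`,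
which is `−1` whenever `μ = 2C − 1` — the far-field law `F ∝ e^{−S} = z^{−ε}` holds for EVERY `C`, so it does not constrain `C`;
only the mass condition does. [new here — MODEL closure algebra; asym/LIMIT-ANALYSIS §4] -/
theorem drainTailRate (μ C : ℝ) (hμ : μ = 2 * C - 1) :
    (μ - 4 * C * (1 / 2) - 0 / 3) / (2 * (1 / 2)) = μ - 2 * C ∧ μ - 2 * C = -1 := by
  constructor
  · ring
  · linarith

/-- **Slow-time form**: with `dΛ/dS = γ/2` and `dγ/dS = γ(μ − 4CΛ − γ/3)/(2Λ)` (`Λ ≠ 0`, `γ ≠ 0`), the orbit slope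
`(dγ/dS)/(dΛ/dS)` is `(μ − 4CΛ − γ/3)/Λ` — the equation solved by `drainOrbit_linear`. [new here — MODEL closure algebra] -/
theorem drainOrbit_slope (μ C Λ γ : ℝ) (hΛ : Λ ≠ 0) (hγ : γ ≠ 0) :
    (γ * (μ - 4 * C * Λ - γ / 3) / (2 * Λ)) / (γ / 2) = (μ - 4 * C * Λ - γ / 3) / Λ := by
  rw [div_eq_div_iff (div_ne_zero hγ two_ne_zero) hΛ]
  field_simp

end ElgindiDrainClosure
end Summit.NavierStokesRegularity.OSWSelfSimilar
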